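import Summits.QuantumFields.YangMills.Theorems.UnitScaleTiltHalvingP1FlatPillar
import Summits.QuantumFields.YangMills.Theorems.UnitScaleTiltProp8HalvingSliceMultiplier
import Literature.MathematicalPhysics.QuantumFieldTheory.Balaban1983to89.BlockAveragingExpMeanLog
import Literature.MathematicalPhysics.QuantumFieldTheory.Balaban1983to89.B7Prop4Flat
import HarnessLib

/-!
# Route `UnitScaleTilt`, crux K1 child «MinimiserStabilityRegPr» (stmt-QuantumFields-19200), registered stub V2′ `stub_halvingStep` (v10 `BirthV10`) —
# **J5 EXTRACTION: THE CORE `core′` OF PILLAR P1♭ (v1.1 text ✓`HalvingP1FlatPillarPrime.P1FlatPillarAt'`, first five conjunct groups (o)(i)(ii′)(iii)(iv))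
# FROM THE OUTPUT OF THE FLAT ONE-CONTRACTION (T2♭-PLAN v1.1, bricks J1–J4): the two dictionaries (iv) «exact Landau slice `R∂*(φ∘A) = 0` for every real
# reading ⟹ matrix-multiplier form» and (i) «exponential coordinate of an `SU(2)` element is Hermitian and traceless», and the packaging theorems**

Cell `ym3-torus` (HUMAN RULING D-0037, YM ladder rung R3 — continuum SU(2) YM₃ on the three-torus is a RUNG, NOT the Clay problem), width seat
`ym-ust-19936-w7` gen 4, cross-item hand on line H (★★OWNER ym3-torus-plan g26 ACK 45 (a): «J5 EXTRACTION → ★w7-19936 g4: GO»; tag worded by the OWNER: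
`--supports stmt-QuantumFields-19200 --as helper`).  Definition-free, 0 sorry, standard axioms.

WHY.  LEAD-H ★w5-19200 g4's T2♭-PLAN (19200 evidence #44, v1.1 addendum #46) produces the `core` of WANTED №g26-5 — [Balaban1985RegularSpaces] Thm 2 at background
`U₀ = 1` on the aligned cube sequence, plus the designed top normalisation (o) — by a flat one-contraction (J1 letters, J3 pre-gauge, J4 the joint fixed point:
exact slice `R∂*A = 0` componentwise and (o) exact).  The LAST row («J5 = v1.0 B5») reads the fixed point's output `(u, A)` and delivers the ∃-text `core′` =
the first five conjunct groups of ✓`P1FlatPillarAt'` VERBATIM, from which ✓`HalvingP1FlatPillarRows.p1FlatPillarAt_of_core` ∕ ✓`p1FlatPillarAt_of_prime` and the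
door ✓`HalvingStepOfPillars.halvingStep_of_rows` (twin ′) consume it.  This file types that row AGAINST DISPLAYED BINDERS in the plan's letters, so that J4's output
plugs in by `exact`:
* §1 ★ `multiplier_of_slice` — the (iv)-dictionary: `(∀ φ : M₂(ℂ) →ₗ[ℝ] ℝ, R ∂*(φ∘A) = 0) ⟹ ∃ μ : 𝔅 → M₂(ℂ), Δ∂*A(s) = Σ_{i∈𝔅} (Q′_{j(i)}e_s)(i)•μ(i)` — the CONVERSE
  of ✓`HalvingSliceMultiplier.slice_of_matrixMultiplier`, assembled entrywise (real and imaginary parts of the four entries) from ✓`exists_QpsE_of_RE_eq_zero`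
  (`(ker Q′)ᗮ = range Q′*`) and ✓`QpsE_apply_eq_sum`.
* §2 ★ `isSelfAdjoint_and_trace_zero_of_chart` — the (i)-dictionary: `W ∈ U(2)`, `det W = 1`, `‖W − 1‖ ≤ 1∕4`, `i·η·X = log W`, `η ≠ 0` ⟹ `X* = X`, `tr X = 0`
  (lit ✓`BlockAveragingExpMeanLog.star_mlog_eq_neg` ∕ `trace_mlog_eq_zero_of_det_eq_one`).
* §3 ★★ `core'_of_chartData` — packaging: (o), (i), (ii′), (iii) handed VERBATIM + the exact slice in `RE ∘ dsE` letters ⟹ `core′`.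
* §4 ★★ `core'_of_mlogChart` — the chart-DEFINED variant: an `SU(2)`-valued gauge `u`, the chart `i·η·A(b) = log(u(z)⁻¹U(b)u(z+e_μ))` on the bonds with both
  ends in `Ω₀` with `‖· − 1‖ ≤ 1∕4` (T2♭-PLAN F-a sizes), `A = 0` off them, (iii) verbatim, the exact slice ⟹ `core′` ((ii′) by ✓`B7Prop4Flat.expUnit_mlog`, (i) by §2).
HONEST SCOPE.  Dictionaries and packaging; NOTHING of J4's analysis (the contraction, the (1.59)♭ bound, the sizes (iii)) is proved here — they are hypotheses.
NOT a claim about [Balaban1985RegularSpaces] Thm 2, the stub, the crux, the rung or the mass gap; no summit statement is proved by this seat.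

References: T. Bałaban, CMP **99** (1985) 75–102 [Balaban1985RegularSpaces] Thm 2 p.83, (1.36)–(1.38) p.82; CMP **96** (1984) 223–250 [Balaban1984PropagatorsII]
(2.7)–(2.15) pp.224–225; CMP **102** (1985) 277–309 [Balaban1985Variational] (150)–(156) pp.301–302; CMP **98** (1985) 17–51 [Balaban1985Averaging] (19)–(23) p.21.
-/

set_option autoImplicit false

noncomputable section

open scoped BigOperators Matrix.Norms.L2Operator

namespace Summit.QuantumFields.YangMills.Theorems.HalvingP1FlatCoreExtraction

open Literature.MathematicalPhysics.QuantumFieldTheory.Balaban1983to89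
open Literature.MathematicalPhysics.QuantumFieldTheory.Balaban1983to89.T3ContinuumYM3Torus
open Complex (I)
open MatrixLog (mlog)
open B6SectADomainsV1 (Domains)
open B6SectAOperatorsV1 (SiteIdx SiteIdxSpace ScalarSpace QpsE RE dsE lapE lapE_apply)
open B7Prop1Explicit (expUnit)
open B7Prop4Flat (expUnit_mlog)
open B10Eq27TorusAxialLog (transl unitsField toUField suIncl val_suIncl)
open LatticeFieldCalculus (laplace diverg siteAvgIter)
open FlatCubeOpsText (IsLevWeight)
open HalvingP1FlatPillar (DP1Clause)
open HalvingSliceMultiplier (exists_QpsE_of_RE_eq_zero QpsE_apply_eq_sum diverg_reading laplace_reading)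

variable {F : T3Family} {n K : ℕ}

/-! ## §1 The (iv)-dictionary: exact slice for every real reading ⟹ matrix-multiplier form -/

/-- ★ **THE MATRIX MULTIPLIER FROM THE READ SLICES** — converse of ✓`HalvingSliceMultiplier.slice_of_matrixMultiplier`: if `R ∂*(φ∘A) = 0` for every
`ℝ`-linear reading `φ : M₂(ℂ) → ℝ` (lattice factor `L^{K−n}`), then `Δ(∂*A)(s) = Σ_{i∈𝔅} (Q′_{j(i)}e_s)(i)•μ(i)` for a matrix-valued multiplier `μ` on the site index set
of `D` — conjunct (iv) of ✓`P1FlatPillarAt'`.  Entrywise: each of the eight real coordinates of `M₂(ℂ)` gets its scalar multiplier from `(ker Q′)ᗮ = range Q′*`.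
[cite: Balaban1985RegularSpaces, (1.38) p.82, (1.146) p.101; Balaban1984PropagatorsII, (2.9)-(2.15) pp.224-225] -/
theorem multiplier_of_slice (D : Domains (F.P K)) {A : PBond (F.P K) 0 → Matrix (Fin 2) (Fin 2) ℂ}
    (hslice : ∀ φ : Matrix (Fin 2) (Fin 2) ℂ →ₗ[ℝ] ℝ,
      RE D ((F.L : ℝ) ^ (K - n)) (dsE ((F.L : ℝ) ^ (K - n)) (WithLp.toLp 2 (fun b => φ (A b)))) = 0) :
    ∃ μ : SiteIdx D → Matrix (Fin 2) (Fin 2) ℂ, ∀ s : Site (F.P K) 0,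
      laplace ((F.L : ℝ) ^ (K - n)) (diverg ((F.L : ℝ) ^ (K - n)) A) s =
        ∑ i : SiteIdx D, siteAvgIter (i.1.1 : ℕ) (Pi.single s (1 : ℝ)) i.1.2 • μ i := by
  set c : ℝ := (F.L : ℝ) ^ (K - n) with hc
  -- every real reading of `Δ∂*A` has a scalar multiplier
  have key : ∀ φ : Matrix (Fin 2) (Fin 2) ℂ →ₗ[ℝ] ℝ, ∃ ν : SiteIdx D → ℝ, ∀ s : Site (F.P K) 0,
      φ (laplace c (diverg c A) s) = ∑ i : SiteIdx D, siteAvgIter (i.1.1 : ℕ) (Pi.single s (1 : ℝ)) i.1.2 * ν i := by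
    intro φ
    obtain ⟨μ, hμ⟩ := exists_QpsE_of_RE_eq_zero D c (hslice φ)
    refine ⟨fun i => μ i, fun s => ?_⟩
    have h := congrArg (fun v : ScalarSpace (F.P K) => v s) hμ
    simp only at h
    rw [lapE_apply, QpsE_apply_eq_sum] at h
    have hds : WithLp.ofLp (dsE c (WithLp.toLp 2 (fun b => φ (A b)))) = fun x => φ (diverg c A x) := by
      funext x
      exact diverg_reading _ φ A x
    rw [hds, laplace_reading] at h
    rw [h]
    exact Finset.sum_congr rfl fun i _ => mul_comm _ _
  -- the eight coordinate readings
  let φre : Fin 2 → Fin 2 → (Matrix (Fin 2) (Fin 2) ℂ →ₗ[ℝ] ℝ) := fun j k =>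
    { toFun := fun M => (M j k).re
      map_add' := fun M N => by simp only [Matrix.add_apply, Complex.add_re]
      map_smul' := fun r M => by
        simp only [Matrix.smul_apply, Complex.real_smul, Complex.re_ofReal_mul, RingHom.id_apply, smul_eq_mul] }
  let φim : Fin 2 → Fin 2 → (Matrix (Fin 2) (Fin 2) ℂ →ₗ[ℝ] ℝ) := fun j k =>
    { toFun := fun M => (M j k).im
      map_add' := fun M N => by simp only [Matrix.add_apply, Complex.add_im]
      map_smul' := fun r M => by
        simp only [Matrix.smul_apply, Complex.real_smul, Complex.im_ofReal_mul, RingHom.id_apply, smul_eq_mul] }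
  have hφre : ∀ j k (M : Matrix (Fin 2) (Fin 2) ℂ), φre j k M = (M j k).re := fun _ _ _ => rfl
  have hφim : ∀ j k (M : Matrix (Fin 2) (Fin 2) ℂ), φim j k M = (M j k).im := fun _ _ _ => rfl
  choose νre hνre using fun j k => key (φre j k)
  choose νim hνim using fun j k => key (φim j k)
  refine ⟨fun i => Matrix.of fun j k => (⟨νre j k i, νim j k i⟩ : ℂ), fun s => ?_⟩
  ext j k
  apply Complex.ext
  · have h := hνre j k s
    rw [hφre] at h
    rw [h, Matrix.sum_apply, Complex.re_sum]
    refine Finset.sum_congr rfl fun i _ => ?_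
    show _ = ((siteAvgIter (i.1.1 : ℕ) (Pi.single s (1 : ℝ)) i.1.2 •
      (Matrix.of fun j k => (⟨νre j k i, νim j k i⟩ : ℂ))) j k).re
    rw [Matrix.smul_apply, Matrix.of_apply, Complex.real_smul, Complex.re_ofReal_mul]
  · have h := hνim j k s
    rw [hφim] at h
    rw [h, Matrix.sum_apply, Complex.im_sum]
    refine Finset.sum_congr rfl fun i _ => ?_
    show _ = ((siteAvgIter (i.1.1 : ℕ) (Pi.single s (1 : ℝ)) i.1.2 •
      (Matrix.of fun j k => (⟨νre j k i, νim j k i⟩ : ℂ))) j k).im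
    rw [Matrix.smul_apply, Matrix.of_apply, Complex.real_smul, Complex.im_ofReal_mul]

/-! ## §2 The (i)-dictionary: the exponential coordinate of an `SU(2)` element is Hermitian and traceless -/

/-- ★ **`i·η·X = log W`, `W ∈ U(2)`, `det W = 1`, `‖W − 1‖ ≤ 1∕4`, `η ≠ 0` ⟹ `X` IS SELF-ADJOINT AND TRACELESS** — conjunct (i) of ✓`P1FlatPillarAt'` for a
chart-defined one-form: `(log W)* = −log W` for unitary `W` near `1` and `tr log W = 0` when moreover `det W = 1` (`2‖W − 1‖ < π`).
[cite: Balaban1985Averaging, (20)-(23) p.21; Balaban1985RegularSpaces, (1.36) p.82] -/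
theorem isSelfAdjoint_and_trace_zero_of_chart {W X : Matrix (Fin 2) (Fin 2) ℂ} (hW : W ∈ Matrix.unitaryGroup (Fin 2) ℂ)
    (hdet : W.det = 1) (hW1 : ‖W - 1‖ ≤ 1 / 4) {η : ℝ} (hη : η ≠ 0) (hX : I • ((η : ℝ) • X) = mlog W) :
    IsSelfAdjoint X ∧ Matrix.trace X = 0 := by
  have h3 : ‖W - 1‖ ≤ 1 / 3 := hW1.trans (by norm_num)
  have hstar : star (mlog W) = -mlog W := ExpMeanLog.star_mlog_eq_neg hW h3
  have hπ : (Fintype.card (Fin 2) : ℝ) * ‖W - 1‖ < Real.pi := by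
    rw [Fintype.card_fin]
    have := Real.pi_gt_three
    push_cast
    nlinarith [norm_nonneg (W - 1)]
  have htr : (mlog W).trace = 0 := ExpMeanLog.trace_mlog_eq_zero_of_det_eq_one hdet h3 hπ
  refine ⟨?_, ?_⟩
  · -- `X* = X`: apply `star` to the chart
    have h1 : star (I • ((η : ℝ) • X)) = -(I • ((η : ℝ) • X)) := by rw [hX, hstar]
    rw [star_smul, star_smul, Complex.star_def, Complex.conj_I, star_trivial, neg_smul, neg_inj] at h1
    have h2 : (η : ℝ) • star X = (η : ℝ) • X := smul_right_injective _ Complex.I_ne_zero h1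
    exact smul_right_injective _ hη h2
  · -- `tr X = 0`: take the trace of the chart
    have h1 : I • ((η : ℝ) • Matrix.trace X) = 0 := by
      rw [← Matrix.trace_smul, ← Matrix.trace_smul, hX, htr]
    rcases smul_eq_zero.1 h1 with h | h
    · exact absurd h Complex.I_ne_zero
    · rcases smul_eq_zero.1 h with h' | h'
      · exact absurd h' hη
      · exact h'

/-! ## §3 `core′` from J4's output handed verbatim (packaging over §1) -/

/-- ★★ **`core′` FROM THE FIXED POINT'S OUTPUT, (o)(i)(ii′)(iii) VERBATIM + THE EXACT SLICE IN `R ∘ ∂*` LETTERS** — the ∃-text formed by the first five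
conjunct groups of ✓`HalvingP1FlatPillarPrime.P1FlatPillarAt'` (generic nested family `D` and chart region `Ω₀`; the door reads `D := cubeSeqMT3 …`,
`Ω₀ := cubeSetM x (K−n) ρ S M 0`), from a gauge `u`, a one-form `A`, the D-P1 clause (o), Hermitian∕traceless `A`, the chart identity (ii′) on the bonds with both
ends in `Ω₀`, the (1.36)♭ sizes (iii) at the level weights, and J4's exact Landau slice `R∂*(φ∘A) = 0` for every real reading `φ` ((iv) by §1).
[cite: Balaban1985RegularSpaces, Thm 2 p.83, (1.36)-(1.38) p.82; Balaban1985Variational, (150)-(156) pp.301-302] -/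
theorem core'_of_chartData (D : Domains (F.P K)) (Ω₀ : Set (Site (F.P K) 0)) (x : Site (F.P K) 0) {ε₀ B₁ : ℝ}
    {U : GaugeField (F.P K) 0 (Matrix.specialUnitaryGroup (Fin 2) ℂ)}
    (u : GaugeTransf (F.P K) 0 (Matrix.unitaryGroup (Fin 2) ℂ)) (A : PBond (F.P K) 0 → Matrix (Fin 2) (Fin 2) ℂ)
    (ho : DP1Clause F n K D x U u)
    (hsa : ∀ b : PBond (F.P K) 0, IsSelfAdjoint (A b)) (htr : ∀ b : PBond (F.P K) 0, Matrix.trace (A b) = 0)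
    (hchart : ∀ (z : B7Prop1Explicit.Site (F.P K).d) (μ : Fin (F.P K).d), transl (0 : Site (F.P K) 0) z ∈ Ω₀ →
      (transl (0 : Site (F.P K) 0) z).shift μ ∈ Ω₀ →
      (Unitary.toUnits (u (transl 0 z)))⁻¹ * unitsField (toUField U) ⟨transl 0 z, μ⟩ * Unitary.toUnits (u ((transl 0 z).shift μ)) =
        expUnit (I • ((((F.L : ℝ)⁻¹) ^ (K - n)) • A ⟨transl 0 z, μ⟩)))
    (hsize : ∀ w : ℕ → PBond (F.P K) 0 → ℝ, IsLevWeight F n K D w →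
      (∀ b : PBond (F.P K) 0, w 1 b * ‖A b‖ ≤ B₁ * ε₀) ∧
      (∀ (b : PBond (F.P K) 0) (ν : Fin (F.P K).d), w 2 b * (F.L : ℝ) ^ (K - n) * ‖A ⟨b.src.shift ν, b.dir⟩ - A b‖ ≤ B₁ * ε₀))
    (hslice : ∀ φ : Matrix (Fin 2) (Fin 2) ℂ →ₗ[ℝ] ℝ,
      RE D ((F.L : ℝ) ^ (K - n)) (dsE ((F.L : ℝ) ^ (K - n)) (WithLp.toLp 2 (fun b => φ (A b)))) = 0) :
    ∃ (u : GaugeTransf (F.P K) 0 (Matrix.unitaryGroup (Fin 2) ℂ)) (A : PBond (F.P K) 0 → Matrix (Fin 2) (Fin 2) ℂ),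
      DP1Clause F n K D x U u ∧
      (∀ b : PBond (F.P K) 0, IsSelfAdjoint (A b)) ∧ (∀ b : PBond (F.P K) 0, Matrix.trace (A b) = 0) ∧
      (∀ (z : B7Prop1Explicit.Site (F.P K).d) (μ : Fin (F.P K).d), transl (0 : Site (F.P K) 0) z ∈ Ω₀ →
        (transl (0 : Site (F.P K) 0) z).shift μ ∈ Ω₀ →
        (Unitary.toUnits (u (transl 0 z)))⁻¹ * unitsField (toUField U) ⟨transl 0 z, μ⟩ * Unitary.toUnits (u ((transl 0 z).shift μ)) =
          expUnit (I • ((((F.L : ℝ)⁻¹) ^ (K - n)) • A ⟨transl 0 z, μ⟩))) ∧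
      (∀ w : ℕ → PBond (F.P K) 0 → ℝ, IsLevWeight F n K D w →
        (∀ b : PBond (F.P K) 0, w 1 b * ‖A b‖ ≤ B₁ * ε₀) ∧
        (∀ (b : PBond (F.P K) 0) (ν : Fin (F.P K).d), w 2 b * (F.L : ℝ) ^ (K - n) * ‖A ⟨b.src.shift ν, b.dir⟩ - A b‖ ≤ B₁ * ε₀)) ∧
      (∃ μ : SiteIdx D → Matrix (Fin 2) (Fin 2) ℂ, ∀ s : Site (F.P K) 0,
        laplace ((F.L : ℝ) ^ (K - n)) (diverg ((F.L : ℝ) ^ (K - n)) A) s =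
          ∑ i : SiteIdx D, siteAvgIter (i.1.1 : ℕ) (Pi.single s (1 : ℝ)) i.1.2 • μ i) :=
  ⟨u, A, ho, hsa, htr, hchart, hsize, multiplier_of_slice D hslice⟩

/-! ## §4 `core′` from a chart-DEFINED one-form and an `SU(2)`-valued gauge -/

/-- The chart unit of a bond under an `SU(2)`-valued gauge is the included `SU(2)` element `u(z)⁻¹·U(b)·u(z′)`. [folklore] -/
theorem chartUnit_eq_toUnits_suIncl (u : GaugeTransf (F.P K) 0 (Matrix.specialUnitaryGroup (Fin 2) ℂ))
    (U : GaugeField (F.P K) 0 (Matrix.specialUnitaryGroup (Fin 2) ℂ)) (s t : Site (F.P K) 0) (b : PBond (F.P K) 0) :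
    (Unitary.toUnits (suIncl (u s)))⁻¹ * unitsField (toUField U) b * Unitary.toUnits (suIncl (u t)) =
      Unitary.toUnits (suIncl ((u s)⁻¹ * U b * u t)) := by
  rw [map_mul, map_mul, map_mul, map_mul, map_inv, map_inv]
  rfl

/-- The matrix of that chart unit: unitary, of determinant `1`. [folklore] -/
theorem chartUnit_mem (u : GaugeTransf (F.P K) 0 (Matrix.specialUnitaryGroup (Fin 2) ℂ))
    (U : GaugeField (F.P K) 0 (Matrix.specialUnitaryGroup (Fin 2) ℂ)) (s t : Site (F.P K) 0) (b : PBond (F.P K) 0) :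
    (((Unitary.toUnits (suIncl (u s)))⁻¹ * unitsField (toUField U) b * Unitary.toUnits (suIncl (u t)) :
        (Matrix (Fin 2) (Fin 2) ℂ)ˣ) : Matrix (Fin 2) (Fin 2) ℂ) ∈ Matrix.unitaryGroup (Fin 2) ℂ ∧
      (((Unitary.toUnits (suIncl (u s)))⁻¹ * unitsField (toUField U) b * Unitary.toUnits (suIncl (u t)) :
        (Matrix (Fin 2) (Fin 2) ℂ)ˣ) : Matrix (Fin 2) (Fin 2) ℂ).det = 1 := by
  rw [chartUnit_eq_toUnits_suIncl, Unitary.val_toUnits_apply, val_suIncl]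
  exact Matrix.mem_specialUnitaryGroup_iff.1 ((u s)⁻¹ * U b * u t).2

/-- ★★ **`core′` FROM A CHART-DEFINED ONE-FORM** (T2♭-PLAN §3 B5∕J5): an `SU(2)`-valued gauge `u` with the D-P1 clause (o) (read through the inclusion
`SU(2) ≤ U(2)`), the near-identity of the gauged bond variables `W_b = u(z)⁻¹U(b)u(z+e_μ)` on the bonds with both ends in `Ω₀` (`‖W_b − 1‖ ≤ 1∕4` — the F-a sizes of
the plan leave room to spare), the one-form `A` DEFINED there by `i·η·A(b) = log W_b` (`η = L^{−(K−n)}`) and `= 0` off those bonds, the (1.36)♭ sizes (iii), and the exact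
slice `R∂*(φ∘A) = 0` for every real reading: then `core′` holds — (ii′) by `e^{log W} = W` (✓`B7Prop4Flat.expUnit_mlog`), (i) by §2 on the chart bonds and trivially
off them, (iv) by §1. [cite: Balaban1985RegularSpaces, Thm 2 p.83, (1.36)-(1.38) p.82; Balaban1985Variational, (150)-(156) pp.301-302; Balaban1985Averaging, (21)-(23) p.21] -/
theorem core'_of_mlogChart (D : Domains (F.P K)) (Ω₀ : Set (Site (F.P K) 0)) (x : Site (F.P K) 0) {ε₀ B₁ : ℝ}
    {U : GaugeField (F.P K) 0 (Matrix.specialUnitaryGroup (Fin 2) ℂ)}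
    (u : GaugeTransf (F.P K) 0 (Matrix.specialUnitaryGroup (Fin 2) ℂ)) (A : PBond (F.P K) 0 → Matrix (Fin 2) (Fin 2) ℂ)
    (ho : DP1Clause F n K D x U (fun s => suIncl (u s)))
    (hnear : ∀ (z : B7Prop1Explicit.Site (F.P K).d) (μ : Fin (F.P K).d), transl (0 : Site (F.P K) 0) z ∈ Ω₀ →
      (transl (0 : Site (F.P K) 0) z).shift μ ∈ Ω₀ →
      ‖(((Unitary.toUnits (suIncl (u (transl 0 z))))⁻¹ * unitsField (toUField U) ⟨transl 0 z, μ⟩ *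
          Unitary.toUnits (suIncl (u ((transl 0 z).shift μ))) : (Matrix (Fin 2) (Fin 2) ℂ)ˣ) : Matrix (Fin 2) (Fin 2) ℂ) - 1‖ ≤ 1 / 4)
    (hA : ∀ (z : B7Prop1Explicit.Site (F.P K).d) (μ : Fin (F.P K).d), transl (0 : Site (F.P K) 0) z ∈ Ω₀ →
      (transl (0 : Site (F.P K) 0) z).shift μ ∈ Ω₀ →
      I • ((((F.L : ℝ)⁻¹) ^ (K - n)) • A ⟨transl 0 z, μ⟩) =
        mlog (((Unitary.toUnits (suIncl (u (transl 0 z))))⁻¹ * unitsField (toUField U) ⟨transl 0 z, μ⟩ *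
          Unitary.toUnits (suIncl (u ((transl 0 z).shift μ))) : (Matrix (Fin 2) (Fin 2) ℂ)ˣ) : Matrix (Fin 2) (Fin 2) ℂ))
    (hA0 : ∀ b : PBond (F.P K) 0, ¬ (∃ z : B7Prop1Explicit.Site (F.P K).d, transl (0 : Site (F.P K) 0) z ∈ Ω₀ ∧
      (transl (0 : Site (F.P K) 0) z).shift b.dir ∈ Ω₀ ∧ b = ⟨transl 0 z, b.dir⟩) → A b = 0)
    (hsize : ∀ w : ℕ → PBond (F.P K) 0 → ℝ, IsLevWeight F n K D w →
      (∀ b : PBond (F.P K) 0, w 1 b * ‖A b‖ ≤ B₁ * ε₀) ∧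
      (∀ (b : PBond (F.P K) 0) (ν : Fin (F.P K).d), w 2 b * (F.L : ℝ) ^ (K - n) * ‖A ⟨b.src.shift ν, b.dir⟩ - A b‖ ≤ B₁ * ε₀))
    (hslice : ∀ φ : Matrix (Fin 2) (Fin 2) ℂ →ₗ[ℝ] ℝ,
      RE D ((F.L : ℝ) ^ (K - n)) (dsE ((F.L : ℝ) ^ (K - n)) (WithLp.toLp 2 (fun b => φ (A b)))) = 0) :
    ∃ (u : GaugeTransf (F.P K) 0 (Matrix.unitaryGroup (Fin 2) ℂ)) (A : PBond (F.P K) 0 → Matrix (Fin 2) (Fin 2) ℂ),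
      DP1Clause F n K D x U u ∧
      (∀ b : PBond (F.P K) 0, IsSelfAdjoint (A b)) ∧ (∀ b : PBond (F.P K) 0, Matrix.trace (A b) = 0) ∧
      (∀ (z : B7Prop1Explicit.Site (F.P K).d) (μ : Fin (F.P K).d), transl (0 : Site (F.P K) 0) z ∈ Ω₀ →
        (transl (0 : Site (F.P K) 0) z).shift μ ∈ Ω₀ →
        (Unitary.toUnits (u (transl 0 z)))⁻¹ * unitsField (toUField U) ⟨transl 0 z, μ⟩ * Unitary.toUnits (u ((transl 0 z).shift μ)) =
          expUnit (I • ((((F.L : ℝ)⁻¹) ^ (K - n)) • A ⟨transl 0 z, μ⟩))) ∧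
      (∀ w : ℕ → PBond (F.P K) 0 → ℝ, IsLevWeight F n K D w →
        (∀ b : PBond (F.P K) 0, w 1 b * ‖A b‖ ≤ B₁ * ε₀) ∧
        (∀ (b : PBond (F.P K) 0) (ν : Fin (F.P K).d), w 2 b * (F.L : ℝ) ^ (K - n) * ‖A ⟨b.src.shift ν, b.dir⟩ - A b‖ ≤ B₁ * ε₀)) ∧
      (∃ μ : SiteIdx D → Matrix (Fin 2) (Fin 2) ℂ, ∀ s : Site (F.P K) 0,
        laplace ((F.L : ℝ) ^ (K - n)) (diverg ((F.L : ℝ) ^ (K - n)) A) s =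
          ∑ i : SiteIdx D, siteAvgIter (i.1.1 : ℕ) (Pi.single s (1 : ℝ)) i.1.2 • μ i) := by
  have hη : ((F.L : ℝ)⁻¹) ^ (K - n) ≠ 0 :=
    pow_ne_zero _ (inv_ne_zero (Nat.cast_ne_zero.2 (F.P K).L_pos.ne'))
  -- (i) on every bond
  have hsatr : ∀ b : PBond (F.P K) 0, IsSelfAdjoint (A b) ∧ Matrix.trace (A b) = 0 := by
    intro b
    by_cases hb : ∃ z : B7Prop1Explicit.Site (F.P K).d, transl (0 : Site (F.P K) 0) z ∈ Ω₀ ∧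
        (transl (0 : Site (F.P K) 0) z).shift b.dir ∈ Ω₀ ∧ b = ⟨transl 0 z, b.dir⟩
    · obtain ⟨z, hz, hz', hbz⟩ := hb
      obtain ⟨hWu, hWdet⟩ := chartUnit_mem u U (transl 0 z) ((transl (0 : Site (F.P K) 0) z).shift b.dir) ⟨transl 0 z, b.dir⟩
      have h := isSelfAdjoint_and_trace_zero_of_chart hWu hWdet (hnear z b.dir hz hz') hη (hA z b.dir hz hz')
      rw [hbz]
      exact h
    · rw [hA0 b hb]
      exact ⟨IsSelfAdjoint.zero _, Matrix.trace_zero _ _⟩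
  refine ⟨fun s => suIncl (u s), A, ho, fun b => (hsatr b).1, fun b => (hsatr b).2, fun z μ hz hz' => ?_, hsize,
    multiplier_of_slice D hslice⟩
  -- (ii′): `e^{log W} = W`
  rw [hA z μ hz hz']
  exact (expUnit_mlog (lt_of_le_of_lt (hnear z μ hz hz') (by norm_num))).symm

end Summit.QuantumFields.YangMills.Theorems.HalvingP1FlatCoreExtraction

end
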